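import Literature.MathematicalPhysics.QuantumManyBody.PeriodicBoseGasLocalization
import Literature.MathematicalPhysics.QuantumManyBody.PeriodicBoseGasFourier
import Literature.MathematicalPhysics.QuantumManyBody.BoseGasHardCoreContact
import HarnessLib

/-!
# `BecUvTail` (stmt-AtomisticToContinuum-8823), line `Sketch` — registered stub `stub_collarMass`

Helper for the crux skeleton `Cruxes/BecUvTail/Lines/Sketch.lean` of route `BECInfraredBound`
(`AtomisticToContinuum/BoseEinsteinCondensation`): proves the registered stub `stub_collarMass` verbatim.

For a `C¹` function `u : ℝ³ → ℂ` and `0 < s`, `1 ≤ M`, `(M+1)s ≤ ℓ`, the `L²`-mass of `u` in the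
*collar* `[0,ℓ)³ ∖ [s,ℓ-s]³` of the periodic cell `cell ℓ = [0,ℓ)³` is at most
`(12/M) ∫_cell |u|² + 4(M+1)s² ∫_cell |∇u|²` (`|∇u|² = gradSqC u`): the collar mass is paid by the
total mass with a *small* coefficient plus the kinetic energy (elementary real analysis, no
Fourier series). Proof: (1) the *one-dimensional averaging inequality*: if `f : ℝ → ℂ` has a
continuous derivative and `X, Y ⊆ [a,b]`, then `|f(x)| ≤ |f(y)| + ∫_{(a,b)} |f'|` (fundamental
theorem of calculus), whence, squaring, integrating in `y ∈ Y`, `x ∈ X` and by Cauchy–Schwarz,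
`|Y| ∫_X |f|² ≤ 2|X| ∫_Y |f|² + 2|X||Y|(b-a) ∫_{(a,b)} |f'|²`; with `|X| = s`, `|Y| = Ms`,
`b - a = (M+1)s`: `∫_X |f|² ≤ (2/M) ∫_Y |f|² + 2(M+1)s² ∫ |f'|²`, used at both ends of `[0,ℓ)`;
(2) *Fubini* singling out one coordinate of `ℝ³` (Mathlib's marginal integrals transported along
`PiLp.volume_preserving_toLp`, the one-body version of `lintegral_le_of_forall_line` of
`BoseGasHardCoreContact.lean`; on a line `∂ⱼu` is the derivative, `hasDerivAt_lineSlice`) bounds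
the mass of each of the six slabs `{x ∈ cell | xⱼ < s}`, `{x ∈ cell | ℓ-s < xⱼ}` by
`(2/M) ∫_cell |u|² + 2(M+1)s² ∫_cell |∂ⱼu|²`; (3) the slabs cover the collar and
`∑ⱼ |∂ⱼu|² = |∇u|²`: constants `6 · 2/M = 12/M`, `2 · 2(M+1)s² = 4(M+1)s²`. Sources: standard
Sobolev-space folklore (trace/averaging inequality by FTC and Cauchy–Schwarz, Fubini).
-/

noncomputable section

open MeasureTheory Filter
open scoped ENNReal NNReal BigOperators Interval

namespace Summit.AtomisticToContinuum.BoseEinsteinCondensation.Theorems.BecUvTail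

open Literature.MathematicalPhysics.QuantumManyBody.BoseGas
open Set Function WithLp

/-- `(p + q)² ≤ 2 (p² + q²)` in `ℝ≥0∞`. [folklore] -/
private theorem ennreal_add_sq_le (p q : ℝ≥0∞) : (p + q) ^ 2 ≤ 2 * (p ^ 2 + q ^ 2) := by
  rcases eq_or_ne p ⊤ with rfl | hp
  · simp
  rcases eq_or_ne q ⊤ with rfl | hq
  · simp
  lift p to ℝ≥0 using hp
  lift q to ℝ≥0 using hq
  exact_mod_cast add_sq_le (a := p) (b := q)

/-- Fundamental theorem of calculus: if `f` has the continuous derivative `f'`, then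
`|f(x)| ≤ |f(y)| + ∫_{(a,b)} |f'|` for all `x, y ∈ [a,b]`. [folklore] -/
private theorem ennnorm_le_add_lintegral {f f' : ℝ → ℂ} (hderiv : ∀ t, HasDerivAt f (f' t) t)
    (hcont : Continuous f') {a b x y : ℝ} (hx : x ∈ Icc a b) (hy : y ∈ Icc a b) :
    (‖f x‖₊ : ℝ≥0∞) ≤ ‖f y‖₊ + ∫⁻ t in Ioo a b, (‖f' t‖₊ : ℝ≥0∞) := by
  -- adapted from the `hpt` step of `poincare_Ioo_of_zero` (BoseGasHardCoreContact.lean)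
  have hab : a ≤ b := hx.1.trans hx.2
  have hftc : ∫ t in y..x, f' t = f x - f y :=
    intervalIntegral.integral_eq_sub_of_hasDerivAt (fun t _ => hderiv t)
      (hcont.intervalIntegrable _ _)
  have hn : ‖f x‖ ≤ ‖f y‖ + |∫ t in y..x, ‖f' t‖| := by
    rw [show f x = f y + ∫ t in y..x, f' t by rw [hftc]; ring]
    exact (norm_add_le _ _).trans
      (add_le_add_right intervalIntegral.norm_integral_le_abs_integral_norm _)
  have hsub : Ι y x ⊆ Ι a b := by
    refine uIoc_subset_uIoc_of_uIcc_subset_uIcc (uIcc_subset_uIcc ?_ ?_)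
    · rw [uIcc_of_le hab]; exact hy
    · rw [uIcc_of_le hab]; exact hx
  have hmono : |∫ t in y..x, ‖f' t‖| ≤ |∫ t in a..b, ‖f' t‖| :=
    intervalIntegral.abs_integral_mono_interval hsub
      (Eventually.of_forall fun _ => norm_nonneg _) (hcont.norm.intervalIntegrable _ _)
  have hI0 : 0 ≤ ∫ t in Ioc a b, ‖f' t‖ :=
    setIntegral_nonneg measurableSet_Ioc fun _ _ => norm_nonneg _
  have hint : |∫ t in a..b, ‖f' t‖| = ∫ t in Ioc a b, ‖f' t‖ := by
    rw [intervalIntegral.integral_of_le hab, abs_of_nonneg hI0]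
  have hlin : ENNReal.ofReal (∫ t in Ioc a b, ‖f' t‖) = ∫⁻ t in Ioc a b, (‖f' t‖₊ : ℝ≥0∞) := by
    rw [ofReal_integral_eq_lintegral_ofReal
      ((hcont.norm.integrableOn_Icc).mono_set Ioc_subset_Icc_self)
      (Eventually.of_forall fun _ => norm_nonneg _)]
    simp_rw [ofReal_norm]; rfl
  calc (‖f x‖₊ : ℝ≥0∞) = ENNReal.ofReal ‖f x‖ := (ofReal_norm (f x)).symm
    _ ≤ ENNReal.ofReal (‖f y‖ + ∫ t in Ioc a b, ‖f' t‖) :=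
        ENNReal.ofReal_le_ofReal (hn.trans (add_le_add_right (hmono.trans_eq hint) _))
    _ = ENNReal.ofReal ‖f y‖ + ENNReal.ofReal (∫ t in Ioc a b, ‖f' t‖) :=
        ENNReal.ofReal_add (norm_nonneg _) hI0
    _ = ‖f y‖₊ + ∫⁻ t in Ioc a b, (‖f' t‖₊ : ℝ≥0∞) := by rw [ofReal_norm, hlin]; rfl
    _ = ‖f y‖₊ + ∫⁻ t in Ioo a b, (‖f' t‖₊ : ℝ≥0∞) := by rw [setLIntegral_congr Ioo_ae_eq_Ioc]

/-- **One-dimensional averaging inequality.** If `f` has the continuous derivative `f'` and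
`X, Y ⊆ [a,b]`, then `|Y| ∫_X |f|² ≤ 2|X| ∫_Y |f|² + 2|X| |Y| (b-a) ∫_{(a,b)} |f'|²`
(square `|f(x)| ≤ |f(y)| + ∫|f'|`, integrate in `y ∈ Y` and `x ∈ X`, Cauchy–Schwarz). [folklore] -/
private theorem averaging_mul_le {f f' : ℝ → ℂ} (hderiv : ∀ t, HasDerivAt f (f' t) t)
    (hcont : Continuous f') {a b : ℝ} {X Y : Set ℝ} (hX : X ⊆ Icc a b) (hY : Y ⊆ Icc a b) :
    volume Y * ∫⁻ t in X, (‖f t‖₊ : ℝ≥0∞) ^ 2 ≤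
      2 * volume X * (∫⁻ t in Y, (‖f t‖₊ : ℝ≥0∞) ^ 2) +
        2 * volume X * volume Y *
          (ENNReal.ofReal (b - a) * ∫⁻ t in Ioo a b, (‖f' t‖₊ : ℝ≥0∞) ^ 2) := by
  have hf : Continuous f := continuous_iff_continuousAt.2 fun t => (hderiv t).continuousAt
  have hfm : Measurable fun t => (‖f t‖₊ : ℝ≥0∞) ^ 2 :=
    hf.measurable.nnnorm.coe_nnreal_ennreal.pow_const _
  -- Cauchy–Schwarz for the derivative
  have hCS : (∫⁻ t in Ioo a b, (‖f' t‖₊ : ℝ≥0∞)) ^ 2 ≤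
      ENNReal.ofReal (b - a) * ∫⁻ t in Ioo a b, (‖f' t‖₊ : ℝ≥0∞) ^ 2 := by
    have := setLIntegral_sq_le_measure_mul volume (φ := fun t => (‖f' t‖₊ : ℝ≥0∞))
      hcont.measurable.nnnorm.coe_nnreal_ennreal.aemeasurable (Ioo a b)
    simpa [Real.volume_Ioo] using this
  -- the pointwise bound, integrated in `y ∈ Y`
  have hpt : ∀ x ∈ X, volume Y * (‖f x‖₊ : ℝ≥0∞) ^ 2 ≤
      2 * (∫⁻ t in Y, (‖f t‖₊ : ℝ≥0∞) ^ 2) +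
        2 * (∫⁻ t in Ioo a b, (‖f' t‖₊ : ℝ≥0∞)) ^ 2 * volume Y := by
    intro x hx
    calc volume Y * (‖f x‖₊ : ℝ≥0∞) ^ 2 = ∫⁻ _ in Y, (‖f x‖₊ : ℝ≥0∞) ^ 2 := by
          rw [setLIntegral_const, mul_comm]
      _ ≤ ∫⁻ y in Y, (2 * (‖f y‖₊ : ℝ≥0∞) ^ 2 +
            2 * (∫⁻ t in Ioo a b, (‖f' t‖₊ : ℝ≥0∞)) ^ 2) := by
          refine setLIntegral_mono ((hfm.const_mul _).add_const _) fun y hy => ?_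
          calc (‖f x‖₊ : ℝ≥0∞) ^ 2
                ≤ ((‖f y‖₊ : ℝ≥0∞) + ∫⁻ t in Ioo a b, (‖f' t‖₊ : ℝ≥0∞)) ^ 2 :=
                pow_le_pow_left' (ennnorm_le_add_lintegral hderiv hcont (hX hx) (hY hy)) 2
            _ ≤ 2 * ((‖f y‖₊ : ℝ≥0∞) ^ 2 + (∫⁻ t in Ioo a b, (‖f' t‖₊ : ℝ≥0∞)) ^ 2) :=
                ennreal_add_sq_le _ _
            _ = _ := mul_add _ _ _
      _ = _ := by
          rw [lintegral_add_right _ measurable_const, lintegral_const_mul _ hfm, setLIntegral_const]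
  -- integrate in `x ∈ X`
  calc volume Y * ∫⁻ t in X, (‖f t‖₊ : ℝ≥0∞) ^ 2
        = ∫⁻ t in X, volume Y * (‖f t‖₊ : ℝ≥0∞) ^ 2 := by rw [lintegral_const_mul _ hfm]
    _ ≤ _ := setLIntegral_mono measurable_const hpt
    _ = (2 * (∫⁻ t in Y, (‖f t‖₊ : ℝ≥0∞) ^ 2) +
          2 * (∫⁻ t in Ioo a b, (‖f' t‖₊ : ℝ≥0∞)) ^ 2 * volume Y) * volume X :=
        setLIntegral_const _ _
    _ ≤ (2 * (∫⁻ t in Y, (‖f t‖₊ : ℝ≥0∞) ^ 2) +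
          2 * (ENNReal.ofReal (b - a) * ∫⁻ t in Ioo a b, (‖f' t‖₊ : ℝ≥0∞) ^ 2) * volume Y) *
            volume X := by
        gcongr
    _ = _ := by ring

/-- The averaging inequality with `|X| = s`, `|Y| = Ms`, `b - a = (M+1)s`, divided by `Ms`:
`∫_X |f|² ≤ (2/M) ∫_Y |f|² + 2(M+1)s² ∫_{(a,b)} |f'|²`. [folklore] -/
private theorem averaging_le {f f' : ℝ → ℂ} (hderiv : ∀ t, HasDerivAt f (f' t) t)
    (hcont : Continuous f') {a b s M : ℝ} {X Y : Set ℝ} (hX : X ⊆ Icc a b) (hY : Y ⊆ Icc a b)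
    (hs : 0 < s) (hM : 1 ≤ M) (hvX : volume X = ENNReal.ofReal s)
    (hvY : volume Y = ENNReal.ofReal (M * s)) (hab : b - a = (M + 1) * s) :
    ∫⁻ t in X, (‖f t‖₊ : ℝ≥0∞) ^ 2 ≤
      ENNReal.ofReal (2 / M) * (∫⁻ t in Y, (‖f t‖₊ : ℝ≥0∞) ^ 2) +
        ENNReal.ofReal (2 * (M + 1) * s ^ 2) * ∫⁻ t in Ioo a b, (‖f' t‖₊ : ℝ≥0∞) ^ 2 := by
  have h := averaging_mul_le hderiv hcont hX hY
  rw [hvX, hvY, hab] at h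
  have hM0 : 0 < M := by linarith
  have hMs : 0 < M * s := mul_pos hM0 hs
  have h2 : (2 : ℝ≥0∞) = ENNReal.ofReal 2 := by norm_num
  have e1 : (2 : ℝ≥0∞) * ENNReal.ofReal s = ENNReal.ofReal (M * s) * ENNReal.ofReal (2 / M) := by
    rw [h2, ← ENNReal.ofReal_mul (by norm_num : (0 : ℝ) ≤ 2), ← ENNReal.ofReal_mul hMs.le]
    congr 1; field_simp
  have e2 : (2 : ℝ≥0∞) * ENNReal.ofReal s * ENNReal.ofReal (M * s) * ENNReal.ofReal ((M + 1) * s) =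
      ENNReal.ofReal (M * s) * ENNReal.ofReal (2 * (M + 1) * s ^ 2) := by
    rw [h2, ← ENNReal.ofReal_mul (by norm_num : (0 : ℝ) ≤ 2),
      ← ENNReal.ofReal_mul (by positivity : (0 : ℝ) ≤ 2 * s),
      ← ENNReal.ofReal_mul (by positivity : (0 : ℝ) ≤ 2 * s * (M * s)),
      ← ENNReal.ofReal_mul hMs.le]
    congr 1; ring
  rw [← ENNReal.mul_le_mul_iff_right (a := ENNReal.ofReal (M * s))
    (ENNReal.ofReal_pos.2 hMs).ne' ENNReal.ofReal_ne_top]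
  calc ENNReal.ofReal (M * s) * ∫⁻ t in X, (‖f t‖₊ : ℝ≥0∞) ^ 2 ≤ _ := h
    _ = ENNReal.ofReal (M * s) * ENNReal.ofReal (2 / M) * (∫⁻ t in Y, (‖f t‖₊ : ℝ≥0∞) ^ 2) +
          ENNReal.ofReal (M * s) * ENNReal.ofReal (2 * (M + 1) * s ^ 2) *
            ∫⁻ t in Ioo a b, (‖f' t‖₊ : ℝ≥0∞) ^ 2 := by
        rw [← e1, ← e2]; ring
    _ = _ := by ring

/-- The averaging inequality at the two ends of `[0, ℓ)`: for `X = [0,s)` or `X = (ℓ-s,ℓ)` and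
`(M+1)s ≤ ℓ`, `∫_X |f|² ≤ ∫_{[0,ℓ)} ((2/M)|f|² + 2(M+1)s²|f'|²)`. [folklore] -/
private theorem line_bound {ℓ s M : ℝ} (hs : 0 < s) (hM : 1 ≤ M) (hℓ : (M + 1) * s ≤ ℓ)
    {f f' : ℝ → ℂ} (hderiv : ∀ t, HasDerivAt f (f' t) t) (hcont : Continuous f')
    {X : Set ℝ} (hX : X = Ico 0 s ∨ X = Ioo (ℓ - s) ℓ) :
    ∫⁻ t in X, (‖f t‖₊ : ℝ≥0∞) ^ 2 ≤
      ∫⁻ t in Ico 0 ℓ, (ENNReal.ofReal (2 / M) * (‖f t‖₊ : ℝ≥0∞) ^ 2 +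
        ENNReal.ofReal (2 * (M + 1) * s ^ 2) * (‖f' t‖₊ : ℝ≥0∞) ^ 2) := by
  have hf : Continuous f := continuous_iff_continuousAt.2 fun t => (hderiv t).continuousAt
  have hfm : Measurable fun t => (‖f t‖₊ : ℝ≥0∞) ^ 2 :=
    hf.measurable.nnnorm.coe_nnreal_ennreal.pow_const _
  have hf'm : Measurable fun t => (‖f' t‖₊ : ℝ≥0∞) ^ 2 :=
    hcont.measurable.nnnorm.coe_nnreal_ennreal.pow_const _
  rw [lintegral_add_left (hfm.const_mul _), lintegral_const_mul _ hfm, lintegral_const_mul _ hf'm]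
  have hMs : 0 ≤ M * s := mul_nonneg (by linarith) hs.le
  rcases hX with rfl | rfl
  · -- near `0`: `[a,b] = [0,(M+1)s]`, `Y = [s,(M+1)s)`
    have h := averaging_le hderiv hcont (a := 0) (b := (M + 1) * s) (X := Ico 0 s)
      (Y := Ico s ((M + 1) * s))
      (Ico_subset_Icc_self.trans (Icc_subset_Icc_right (by linarith)))
      (Ico_subset_Icc_self.trans (Icc_subset_Icc_left hs.le)) hs hM
      (by rw [Real.volume_Ico, sub_zero]) (by rw [Real.volume_Ico]; congr 1; ring) (by ring)
    refine h.trans (add_le_add ?_ ?_)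
    · exact mul_le_mul_right (lintegral_mono_set (Ico_subset_Ico hs.le hℓ)) _
    · exact mul_le_mul_right
        (lintegral_mono_set (Ioo_subset_Ico_self.trans (Ico_subset_Ico_right hℓ))) _
  · -- near `ℓ`: `[a,b] = [ℓ-(M+1)s, ℓ]`, `Y = (ℓ-(M+1)s, ℓ-s]`
    have h := averaging_le hderiv hcont (a := ℓ - (M + 1) * s) (b := ℓ) (X := Ioo (ℓ - s) ℓ)
      (Y := Ioc (ℓ - (M + 1) * s) (ℓ - s))
      (Ioo_subset_Icc_self.trans (Icc_subset_Icc_left (by linarith)))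
      (Ioc_subset_Icc_self.trans (Icc_subset_Icc_right (by linarith))) hs hM
      (by rw [Real.volume_Ioo]; congr 1; ring) (by rw [Real.volume_Ioc]; congr 1; ring) (by ring)
    have hY : Ioc (ℓ - (M + 1) * s) (ℓ - s) ⊆ Ico 0 ℓ := fun t ht =>
      ⟨by linarith [ht.1], by linarith [ht.2]⟩
    have hI : Ioo (ℓ - (M + 1) * s) ℓ ⊆ Ico 0 ℓ := fun t ht => ⟨by linarith [ht.1], ht.2⟩
    refine h.trans (add_le_add ?_ ?_)
    · exact mul_le_mul_right (lintegral_mono_set hY) _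
    · exact mul_le_mul_right (lintegral_mono_set hI) _

/-- Fubini singling out the coordinate `k` of `ℝ³`: an inequality of integrals over `ℝ³` holds if
it holds on every line parallel to `e_k`. [folklore] -/
private theorem lintegral_le_of_forall_line₃ (k : Fin 3) {F G : Space → ℝ≥0∞}
    (hF : Measurable F) (hG : Measurable G)
    (h : ∀ y : Fin 3 → ℝ, ∫⁻ t, F (toLp 2 (update y k t)) ≤ ∫⁻ t, G (toLp 2 (update y k t))) :
    ∫⁻ x, F x ≤ ∫⁻ x, G x := by
  -- adapted from `lintegral_le_of_forall_line` (BoseGasHardCoreContact.lean), one-body case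
  have e := PiLp.volume_preserving_toLp (Fin 3)
  rw [← e.lintegral_comp hF, ← e.lintegral_comp hG]
  have hvol3 : (volume : Measure (Fin 3 → ℝ)) = Measure.pi fun _ => volume := rfl
  rw [hvol3]
  refine lintegral_le_of_lmarginal_le {k} (hF.comp e.measurable) (hG.comp e.measurable) ?_
  rw [lmarginal_singleton, lmarginal_singleton]
  exact fun y => h y

/-- The coordinate line is affine: `(y with yⱼ := t) = (y with yⱼ := 0) + t eⱼ`. [folklore] -/
private theorem toLp_update_eq_add_smul (y : Fin 3 → ℝ) (j : Fin 3) (t : ℝ) :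
    (toLp 2 (update y j t) : Space) =
      toLp 2 (update y j 0) + t • EuclideanSpace.single j (1 : ℝ) := by
  ext k
  rcases eq_or_ne k j with rfl | hk
  · simp
  · simp [hk]

/-- **One slab.** For `X = [0,s)` or `X = (ℓ-s,ℓ)` (and `0 < s`, `1 ≤ M`, `(M+1)s ≤ ℓ`), the mass
of a `C¹` function `u` in the slab `{x ∈ [0,ℓ)³ | xⱼ ∈ X}` is at most
`(2/M) ∫_cell |u|² + 2(M+1)s² ∫_cell |∂ⱼu|²` (the averaging inequality on every line parallel
to `eⱼ`, then Fubini). [folklore] -/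
private theorem slab_le {ℓ s M : ℝ} (hs : 0 < s) (hM : 1 ≤ M) (hℓ : (M + 1) * s ≤ ℓ)
    {u : Space → ℂ} (hu : ContDiff ℝ 1 u) (j : Fin 3) {X : Set ℝ}
    (hX : X = Ico 0 s ∨ X = Ioo (ℓ - s) ℓ) :
    ∫⁻ x in {x : Space | x j ∈ X} ∩ cell ℓ, (‖u x‖₊ : ℝ≥0∞) ^ 2 ≤
      ENNReal.ofReal (2 / M) * (∫⁻ x in cell ℓ, (‖u x‖₊ : ℝ≥0∞) ^ 2) +
        ENNReal.ofReal (2 * (M + 1) * s ^ 2) *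
          ∫⁻ x in cell ℓ, (‖fderiv ℝ u x (EuclideanSpace.single j (1 : ℝ))‖₊ : ℝ≥0∞) ^ 2 := by
  have hdiff : Differentiable ℝ u := hu.differentiable one_ne_zero
  have hφm : Measurable fun x : Space => (‖u x‖₊ : ℝ≥0∞) ^ 2 :=
    hu.continuous.measurable.nnnorm.coe_nnreal_ennreal.pow_const _
  have hψc : Continuous fun x : Space => fderiv ℝ u x (EuclideanSpace.single j (1 : ℝ)) :=
    (hu.continuous_fderiv one_ne_zero).clm_apply continuous_const
  have hψm : Measurable fun x : Space =>
      (‖fderiv ℝ u x (EuclideanSpace.single j (1 : ℝ))‖₊ : ℝ≥0∞) ^ 2 :=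
    hψc.measurable.nnnorm.coe_nnreal_ennreal.pow_const _
  have hXm : MeasurableSet X := by
    rcases hX with rfl | rfl
    exacts [measurableSet_Ico, measurableSet_Ioo]
  have hMs1 : s ≤ M * s := by nlinarith
  have hXsub : X ⊆ Ico 0 ℓ := by
    rcases hX with rfl | rfl
    · exact Ico_subset_Ico_right (by linarith)
    · exact fun t ht => ⟨by linarith [ht.1], ht.2⟩
  have hSm : MeasurableSet ({x : Space | x j ∈ X} ∩ cell ℓ) :=
    (hXm.preimage (by fun_prop : Measurable fun x : Space => x j)).inter (measurableSet_cell ℓ)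
  -- the inequality on every coordinate line parallel to `eⱼ`
  have hlines : ∀ y : Fin 3 → ℝ,
      ∫⁻ t, ({x : Space | x j ∈ X} ∩ cell ℓ).indicator (fun x => (‖u x‖₊ : ℝ≥0∞) ^ 2)
          (toLp 2 (update y j t)) ≤
        ∫⁻ t, (cell ℓ).indicator (fun x => ENNReal.ofReal (2 / M) * (‖u x‖₊ : ℝ≥0∞) ^ 2 +
          ENNReal.ofReal (2 * (M + 1) * s ^ 2) *
            (‖fderiv ℝ u x (EuclideanSpace.single j (1 : ℝ))‖₊ : ℝ≥0∞) ^ 2)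
          (toLp 2 (update y j t)) := by
    intro y
    by_cases hP : ∀ k, k ≠ j → y k ∈ Ico 0 ℓ
    swap
    · -- a line missing the cell: the left-hand side vanishes
      have h0 : ∀ t, ({x : Space | x j ∈ X} ∩ cell ℓ).indicator (fun x => (‖u x‖₊ : ℝ≥0∞) ^ 2)
          (toLp 2 (update y j t)) = 0 := by
        intro t
        refine indicator_of_notMem (fun hmem => hP fun k hk => ?_) _
        have hk' : (toLp 2 (update y j t) : Space) k ∈ Ico 0 ℓ := hmem.2 k
        simpa [hk] using hk'
      simp [h0]
    -- membership along the line is a condition on `t` alone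
    have hmem_cell : ∀ t, (toLp 2 (update y j t) : Space) ∈ cell ℓ ↔ t ∈ Ico 0 ℓ := by
      intro t
      refine ⟨fun h => ?_, fun ht k => ?_⟩
      · have hj : (toLp 2 (update y j t) : Space) j ∈ Ico 0 ℓ := h j
        simpa using hj
      · rcases eq_or_ne k j with rfl | hk
        · simpa using ht
        · have hk' := hP k hk
          simpa [hk] using hk'
    have hmem_S : ∀ t, (toLp 2 (update y j t) : Space) ∈ {x : Space | x j ∈ X} ∩ cell ℓ ↔
        t ∈ X := by
      intro t
      refine ⟨fun h => ?_, fun ht => ⟨?_, (hmem_cell t).2 (hXsub ht)⟩⟩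
      · have hj : (toLp 2 (update y j t) : Space) j ∈ X := h.1
        simpa using hj
      · show (toLp 2 (update y j t) : Space) j ∈ X
        simpa using ht
    -- integrals along the line are integrals over `t`
    have hcongr : ∀ {T : Set ℝ} {S : Set Space} (g : Space → ℝ≥0∞), MeasurableSet T →
        (∀ t, (toLp 2 (update y j t) : Space) ∈ S ↔ t ∈ T) →
        ∫⁻ t, S.indicator g (toLp 2 (update y j t)) =
          ∫⁻ t in T, g (toLp 2 (update y j 0) + t • EuclideanSpace.single j (1 : ℝ)) := by
      intro T S g hT hmem
      rw [← lintegral_indicator hT]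
      refine lintegral_congr fun t => ?_
      by_cases ht : t ∈ T
      · rw [indicator_of_mem ((hmem t).2 ht), indicator_of_mem ht, toLp_update_eq_add_smul]
      · rw [indicator_of_notMem (fun h => ht ((hmem t).1 h)), indicator_of_notMem ht]
    rw [hcongr _ hXm hmem_S, hcongr _ measurableSet_Ico hmem_cell]
    -- the restriction of `u` to the line has derivative `∂ⱼu` (`hasDerivAt_lineSlice`)
    exact line_bound hs hM hℓ (hasDerivAt_lineSlice hdiff (toLp 2 (update y j 0)) j)
      (hψc.comp (by fun_prop)) hX
  -- Fubini over the lines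
  calc ∫⁻ x in {x : Space | x j ∈ X} ∩ cell ℓ, (‖u x‖₊ : ℝ≥0∞) ^ 2
        = ∫⁻ x, ({x : Space | x j ∈ X} ∩ cell ℓ).indicator (fun x => (‖u x‖₊ : ℝ≥0∞) ^ 2) x :=
        (lintegral_indicator hSm _).symm
    _ ≤ ∫⁻ x, (cell ℓ).indicator (fun x => ENNReal.ofReal (2 / M) * (‖u x‖₊ : ℝ≥0∞) ^ 2 +
          ENNReal.ofReal (2 * (M + 1) * s ^ 2) *
            (‖fderiv ℝ u x (EuclideanSpace.single j (1 : ℝ))‖₊ : ℝ≥0∞) ^ 2) x :=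
        lintegral_le_of_forall_line₃ j (hφm.indicator hSm)
          (((hφm.const_mul _).add (hψm.const_mul _)).indicator (measurableSet_cell ℓ)) hlines
    _ = ∫⁻ x in cell ℓ, (ENNReal.ofReal (2 / M) * (‖u x‖₊ : ℝ≥0∞) ^ 2 +
          ENNReal.ofReal (2 * (M + 1) * s ^ 2) *
            (‖fderiv ℝ u x (EuclideanSpace.single j (1 : ℝ))‖₊ : ℝ≥0∞) ^ 2) :=
        lintegral_indicator (measurableSet_cell ℓ) _
    _ = _ := by
        rw [lintegral_add_left (hφm.const_mul _), lintegral_const_mul _ hφm,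
          lintegral_const_mul _ hψm]

/-- **Collar mass of a `C¹` function.** For `0 < s`, `1 ≤ M`, `(M+1)s ≤ ℓ` and `u ∈ C¹(ℝ³; ℂ)`,
`∫_{[0,ℓ)³ ∖ [s,ℓ-s]³} |u|² ≤ (12/M) ∫_{[0,ℓ)³} |u|² + 4(M+1)s² ∫_{[0,ℓ)³} |∇u|²`: the mass in the
collar of width `s` of the periodic cell is controlled by the total mass with the *small*
coefficient `12/M` plus the kinetic energy. Proof idea: the collar is covered by the six slabs
`{xⱼ < s}`, `{ℓ - s < xⱼ}` of the cell; on every line parallel to `eⱼ` the one-dimensional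
averaging inequality `∫_X |f|² ≤ (2/M) ∫_Y |f|² + 2(M+1)s² ∫ |f'|²` (`|X| = s`, `|Y| = Ms`; from
`|f(x)| ≤ |f(y)| + ∫ |f'|`, FTC and Cauchy–Schwarz) bounds the slab mass, Fubini integrates over
the lines, and `∑ⱼ |∂ⱼu|² = |∇u|²` collects the constants `6 · 2/M`, `2 · 2(M+1)s²`
(registered stub `stub_collarMass` of stmt-AtomisticToContinuum-8823, verbatim). [folklore] -/
theorem stub_collarMass :
    ∀ (ℓ s M : ℝ), 0 < s → 1 ≤ M → (M + 1) * s ≤ ℓ → ∀ u : EuclideanSpace ℝ (Fin 3) → ℂ, ContDiff ℝ 1 u → ∫⁻ x in Literature.MathematicalPhysics.QuantumManyBody.BoseGas.cell ℓ \ {x : EuclideanSpace ℝ (Fin 3) | ∀ j, x j ∈ Set.Icc s (ℓ - s)}, (‖u x‖₊ : ENNReal) ^ 2 ≤ ENNReal.ofReal (12 / M) * (∫⁻ x in Literature.MathematicalPhysics.QuantumManyBody.BoseGas.cell ℓ, (‖u x‖₊ : ENNReal) ^ 2) + ENNReal.ofReal (4 * (M + 1) * s ^ 2) * ∫⁻ x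 in Literature.MathematicalPhysics.QuantumManyBody.BoseGas.cell ℓ, Literature.MathematicalPhysics.QuantumManyBody.BoseGas.gradSqC u x := by
  intro ℓ s M hs hM hℓ u hu
  -- `∫ |∇u|² = ∑ⱼ ∫ |∂ⱼu|²`
  have hdm : ∀ j : Fin 3, Measurable fun x : Space =>
      (‖fderiv ℝ u x (EuclideanSpace.single j (1 : ℝ))‖₊ : ℝ≥0∞) ^ 2 := fun j =>
    ((hu.continuous_fderiv one_ne_zero).clm_apply
      continuous_const).measurable.nnnorm.coe_nnreal_ennreal.pow_const _
  have hgrad : ∫⁻ x in cell ℓ, gradSqC u x =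
      ∑ j : Fin 3, ∫⁻ x in cell ℓ,
        (‖fderiv ℝ u x (EuclideanSpace.single j (1 : ℝ))‖₊ : ℝ≥0∞) ^ 2 := by
    simp only [gradSqC]
    exact lintegral_finsetSum _ fun j _ => hdm j
  -- the constants
  have hc1 : ENNReal.ofReal (12 / M) = 6 * ENNReal.ofReal (2 / M) := by
    rw [show (6 : ℝ≥0∞) = ENNReal.ofReal 6 by norm_num,
      ← ENNReal.ofReal_mul (by norm_num : (0 : ℝ) ≤ 6)]
    congr 1; ring
  have hc2 : ENNReal.ofReal (4 * (M + 1) * s ^ 2) =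
      2 * ENNReal.ofReal (2 * (M + 1) * s ^ 2) := by
    rw [show (2 : ℝ≥0∞) = ENNReal.ofReal 2 by norm_num,
      ← ENNReal.ofReal_mul (by norm_num : (0 : ℝ) ≤ 2)]
    congr 1; ring
  -- the collar is covered by the six slabs
  have hcover : cell ℓ \ {x : EuclideanSpace ℝ (Fin 3) | ∀ j, x j ∈ Set.Icc s (ℓ - s)} ⊆
      ⋃ j : Fin 3, (({x : Space | x j ∈ Ico 0 s} ∩ cell ℓ) ∪
        ({x : Space | x j ∈ Ioo (ℓ - s) ℓ} ∩ cell ℓ)) := by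
    rintro x ⟨hcell, hnot⟩
    obtain ⟨j, hj⟩ := not_forall.1 hnot
    refine mem_iUnion.2 ⟨j, ?_⟩
    have hc : x j ∈ Ico 0 ℓ := hcell j
    rcases lt_or_ge (x j) s with hlt | hge
    · exact Or.inl ⟨show x j ∈ Ico 0 s from ⟨hc.1, hlt⟩, hcell⟩
    · exact Or.inr ⟨show x j ∈ Ioo (ℓ - s) ℓ from ⟨not_le.1 fun h => hj ⟨hge, h⟩, hc.2⟩, hcell⟩
  calc ∫⁻ x in cell ℓ \ {x : EuclideanSpace ℝ (Fin 3) | ∀ j, x j ∈ Set.Icc s (ℓ - s)},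
          (‖u x‖₊ : ℝ≥0∞) ^ 2
        ≤ ∑ j : Fin 3, ∫⁻ x in ({x : Space | x j ∈ Ico 0 s} ∩ cell ℓ) ∪
            ({x : Space | x j ∈ Ioo (ℓ - s) ℓ} ∩ cell ℓ), (‖u x‖₊ : ℝ≥0∞) ^ 2 :=
        (lintegral_mono_set hcover).trans ((lintegral_iUnion_le _ _).trans_eq (tsum_fintype _))
    _ ≤ ∑ j : Fin 3,
          ((ENNReal.ofReal (2 / M) * (∫⁻ x in cell ℓ, (‖u x‖₊ : ℝ≥0∞) ^ 2) +
            ENNReal.ofReal (2 * (M + 1) * s ^ 2) * ∫⁻ x in cell ℓ,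
              (‖fderiv ℝ u x (EuclideanSpace.single j (1 : ℝ))‖₊ : ℝ≥0∞) ^ 2) +
          (ENNReal.ofReal (2 / M) * (∫⁻ x in cell ℓ, (‖u x‖₊ : ℝ≥0∞) ^ 2) +
            ENNReal.ofReal (2 * (M + 1) * s ^ 2) * ∫⁻ x in cell ℓ,
              (‖fderiv ℝ u x (EuclideanSpace.single j (1 : ℝ))‖₊ : ℝ≥0∞) ^ 2)) :=
        Finset.sum_le_sum fun j _ => (lintegral_union_le _ _ _).trans
          (add_le_add (slab_le hs hM hℓ hu j (Or.inl rfl)) (slab_le hs hM hℓ hu j (Or.inr rfl)))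
    _ = ENNReal.ofReal (12 / M) * (∫⁻ x in cell ℓ, (‖u x‖₊ : ℝ≥0∞) ^ 2) +
          ENNReal.ofReal (4 * (M + 1) * s ^ 2) * ∑ j : Fin 3, ∫⁻ x in cell ℓ,
            (‖fderiv ℝ u x (EuclideanSpace.single j (1 : ℝ))‖₊ : ℝ≥0∞) ^ 2 := by
        rw [hc1, hc2, Fin.sum_univ_three, Fin.sum_univ_three]
        ring
    _ = _ := by rw [hgrad]

end Summit.AtomisticToContinuum.BoseEinsteinCondensation.Theorems.BecUvTail

end
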